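import Literature.IUT.HodgeTheaters.PuncturedEllipticDihedralProfiniteModel
import HarnessLib

/-!
# [IUTchI] §1: the DIHEDRAL PROFINITE MODEL — part 2: the continuous dihedral quotient `ρ̂ : Ŵ ↠ D_l`, the open
# subgroups `Π_X = ρ̂⁻¹(rotations)`, `Π_C̲ = ρ̂⁻¹{1, s}`, `Π_X̲ = Ker ρ̂`, the cusps `ℤ/l`, and the `PuncturedEllipticData`

Mochizuki, *Inter-universal Teichmüller theory I: construction of Hodge theaters*, kurims manuscript (May 2020),
§1 p. 37 (the cartesian diagram `X̲ → X`, `C̲ → C`, `X → C`, `X̲ → C̲`; "`ε⁰` the unique zero cusp of `X̲`, `ε′, ε″`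
the two cusps of `X̲` that lie over `ε̲`") [cite: Mochizuki2012, IUTchI §1 p.37] (D-0012 claim key; series status
DISPUTED — nothing of the series is asserted here); L. Ribes, P. Zalesskii, *Profinite Groups*, Prop. 3.2.2 /
Lemma 3.2.6 [cite: RibesZalesskii2010, Prop 3.2.2].

Cell abc-iut, seat abc-iut-L5-t1 gen 12, L5 ROWS #7 R48 residual «NV-JOINT» (sequel of part 1,
`PuncturedEllipticDihedralProfiniteModel`).  CONTENTS: §1 `ρ̂ : Ŵ →* D_l`, the unique continuous extension of
`ρ : W ↠ D_l` (abc-iut-L5-t1's `ProfiniteCompletion.exists_lift_of_finite`), its values on `η(W)`, openness of its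
fibres, surjectivity; §2 the sign `D_l ↠ ℤ/2` and the subgroups `Π_X := Ker(sgn ∘ ρ̂)` (index `2`), `Π_C̲ :=
ρ̂⁻¹(dihCbar)` (abc-iut-L5-d4's `dihCbar = {1, s r₀}`), `Π_X ∩ Π_C̲ = Ker ρ̂`; §3 the extension `Ŵ ↠ G_k = 1`
(abc-iut-L5-d4's `ProLModel.Gal`); §4 the cusps `ℤ/l` with representatives `D_i := ⟨η(γ_{sec i})⟩⁻ ≤ Ker ρ̂`,
`sec i := val(i + c₀)`; §5 **`DihedralProfiniteModel.datum l h5 : PuncturedEllipticData`** (`l ≥ 5` prime;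
`ε⁰, ε′, ε″, 2ε := 0, 1, −1, 2`; hypothesis (∗) holds because `G_k = 1`) and its `rfl` unfolding.

HONEST LABEL: a group-theoretic model (profinite completion of a topological orbifold group with its dihedral
covering tower), not the étale `π₁` of a `k`-scheme; no instance, no notation, no `Prop`-valued definition; nothing
here bears on [IUTchIII] Cor. 3.12 or asserts that abc is proved or refuted; inhabited ≠ endorsed; no side taken.
-/

noncomputable section

open CategoryTheory Topology ProfiniteGrp DihedralGroup

namespace Literature.IUT.HodgeTheaters

namespace PuncturedEllipticData

namespace DihedralProfiniteModel

open Literature.AnabelianGeometry.AbsoluteAnabelian Literature.IUT.HodgeTheaters.ProfiniteCompletion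

variable (l : ℕ)

/-! ### §0. Instance-free definitions: the sign `D_l ↠ ℤ/2`, label representatives, cusp groups -/

/-- The sign `D_l → ℤ/2`: rotations `↦ 0`, reflections `↦ 1` (the quotient `Gal(X̲/C) ↠ Gal(X/C)`).
[cite: Mochizuki2012, IUTchI §1 p.37] -/
def sgnD : DihedralGroup l →* Multiplicative (ZMod 2) where
  toFun d := match d with
    | r _ => 1
    | sr _ => gσ
  map_one' := rfl
  map_mul' d e := by
    have h11 : gσ * gσ = 1 := by decide
    cases d <;> cases e <;>
      simp only [r_mul_r, r_mul_sr, sr_mul_r, sr_mul_sr, one_mul, mul_one, h11]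

/-- [cite: Mochizuki2012, IUTchI §1 p.37] -/
@[simp] theorem sgnD_r (k : ZMod l) : sgnD l (r k) = 1 := rfl

/-- [cite: Mochizuki2012, IUTchI §1 p.37] -/
@[simp] theorem sgnD_sr (k : ZMod l) : sgnD l (sr k) = gσ := rfl

/-- `sgn d = 1 ↔ d` is a rotation. [cite: Mochizuki2012, IUTchI §1 p.37] -/
theorem sgnD_eq_one_iff (d : DihedralGroup l) : sgnD l d = 1 ↔ ∃ k : ZMod l, d = r k := by
  cases d with
  | r k => exact ⟨fun _ => ⟨k, rfl⟩, fun _ => rfl⟩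
  | sr k =>
    refine ⟨fun h => absurd h (by rw [sgnD_sr]; decide), ?_⟩
    rintro ⟨k', h⟩
    cases h

/-- `sgn` is surjective. [cite: Mochizuki2012, IUTchI §1 p.37] -/
theorem sgnD_surjective : Function.Surjective (sgnD l) := by
  have hcases : ∀ g : Multiplicative (ZMod 2), g = 1 ∨ g = gσ := by decide
  intro g
  rcases hcases g with rfl | rfl
  · exact ⟨r 0, rfl⟩
  · exact ⟨sr 0, rfl⟩

/-- The integer representative `sec i := val(i + c₀)` of the label `i` (so that `lab (sec i) = i`).
[cite: Mochizuki2012, IUTchI §1 p.37] -/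
def sec (i : ZMod l) : ℤ := ((i + (c₀ l : ZMod l)).val : ℤ)

/-- **The decomposition (= inertia) group of the cusp with label `i`**: `D_i := ⟨η(γ_{sec i})⟩⁻ ⊆ Ŵ`.
[cite: Mochizuki2012, IUTchI §1 p.37] -/
def decompW (i : ZMod l) : Subgroup (profiniteCompletion W) :=
  (Subgroup.zpowers (toCompletion W (SemidirectProduct.inl (γ (sec l i))))).topologicalClosure

variable [Fact l.Prime]

/-- `l ≠ 0` (`l` is prime); used to see that `D_l` is finite. [cite: Mochizuki2012, IUTchI §1 p.37] -/
theorem neZero_l : NeZero l := ⟨(Fact.out : l.Prime).ne_zero⟩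

/-! ### §1. The continuous dihedral quotient `ρ̂ : Ŵ ↠ D_l` -/

/-- **`ρ̂ : Ŵ →* D_l`**, the continuous extension of `ρ : W ↠ D_l` to the profinite completion (a choice of
`ProfiniteCompletion.exists_lift_of_finite`). [cite: Mochizuki2012, IUTchI §1 p.37] -/
def ρhat : profiniteCompletion W →* DihedralGroup l :=
  haveI : NeZero l := neZero_l l
  Classical.choose (exists_lift_of_finite (ρW l))

/-- `ρ̂ (η w) = ρ w`. [cite: Mochizuki2012, IUTchI §1 p.37] -/
@[simp] theorem ρhat_eta (w : W) : ρhat l (toCompletion W w) = ρW l w := by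
  haveI : NeZero l := neZero_l l
  exact (Classical.choose_spec (exists_lift_of_finite (ρW l))).1 w

/-- `ρ̂` is continuous for the discrete topology on `D_l`. [cite: Mochizuki2012, IUTchI §1 p.37] -/
theorem continuous_ρhat [TopologicalSpace (DihedralGroup l)] [DiscreteTopology (DihedralGroup l)] :
    Continuous (ρhat l) := by
  haveI : NeZero l := neZero_l l
  exact (Classical.choose_spec (exists_lift_of_finite (ρW l))).2.2

/-- Every fibre set `ρ̂⁻¹(S)` is open. [cite: Mochizuki2012, IUTchI §1 p.37] -/
theorem isOpen_ρhat_preimage (S : Set (DihedralGroup l)) : IsOpen (ρhat l ⁻¹' S) := by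
  letI : TopologicalSpace (DihedralGroup l) := ⊥
  haveI : DiscreteTopology (DihedralGroup l) := ⟨rfl⟩
  exact (isOpen_discrete S).preimage (continuous_ρhat l)

/-- Every fibre set `ρ̂⁻¹(S)` is closed. [cite: Mochizuki2012, IUTchI §1 p.37] -/
theorem isClosed_ρhat_preimage (S : Set (DihedralGroup l)) : IsClosed (ρhat l ⁻¹' S) := by
  letI : TopologicalSpace (DihedralGroup l) := ⊥
  haveI : DiscreteTopology (DihedralGroup l) := ⟨rfl⟩
  exact (isClosed_discrete S).preimage (continuous_ρhat l)

/-- `ρ̂` is surjective (already `ρ` is). [cite: Mochizuki2012, IUTchI §1 p.37] -/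
theorem ρhat_surjective : Function.Surjective (ρhat l) := fun d => by
  haveI : NeZero l := neZero_l l
  obtain ⟨w, rfl⟩ := ρW_surjective l d
  exact ⟨toCompletion W w, ρhat_eta l w⟩

/-- `Ker ρ̂` is closed. [cite: Mochizuki2012, IUTchI §1 p.37] -/
theorem isClosed_ker_ρhat : IsClosed ((ρhat l).ker : Set (profiniteCompletion W)) :=
  isClosed_ρhat_preimage l {1}

/-- `Ker ρ̂` is open. [cite: Mochizuki2012, IUTchI §1 p.37] -/
theorem isOpen_ker_ρhat : IsOpen ((ρhat l).ker : Set (profiniteCompletion W)) :=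
  isOpen_ρhat_preimage l {1}

/-! ### §2. The sign `D_l ↠ ℤ/2` and the subgroups `Π_X`, `Π_C̲`, `Π_X̲ = Ker ρ̂` -/

/-- **`Π_X := Ker(sgn ∘ ρ̂) = ρ̂⁻¹(rotations)`** (the once-punctured torus `X → C`). [cite: Mochizuki2012, IUTchI §1 p.37] -/
def PiXW : Subgroup (profiniteCompletion W) := ((sgnD l).comp (ρhat l)).ker

/-- Membership in `Π_X`: `ρ̂ g` is a rotation. [cite: Mochizuki2012, IUTchI §1 p.37] -/
theorem mem_PiXW_iff (g : profiniteCompletion W) : g ∈ PiXW l ↔ ∃ k : ZMod l, ρhat l g = r k := by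
  rw [PiXW, MonoidHom.mem_ker, MonoidHom.comp_apply, sgnD_eq_one_iff]

/-- `[Ŵ : Π_X] = 2`. [cite: Mochizuki2012, IUTchI §1 p.37] -/
theorem index_PiXW : (PiXW l).index = 2 := by
  have hs : Function.Surjective ((sgnD l).comp (ρhat l)) := (sgnD_surjective l).comp (ρhat_surjective l)
  rw [PiXW, Subgroup.index_ker, MonoidHom.range_eq_top.mpr hs, Subgroup.card_top]
  simp [Nat.card_eq_fintype_card]

/-- `Π_X` is open. [cite: Mochizuki2012, IUTchI §1 p.37] -/
theorem isOpen_PiXW : IsOpen (PiXW l : Set (profiniteCompletion W)) := by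
  have : (PiXW l : Set (profiniteCompletion W)) = ρhat l ⁻¹' {d | sgnD l d = 1} := by
    ext g; rw [SetLike.mem_coe, PiXW, MonoidHom.mem_ker]; rfl
  rw [this]
  exact isOpen_ρhat_preimage l _

/-- `Π_X` is closed. [cite: Mochizuki2012, IUTchI §1 p.37] -/
theorem isClosed_PiXW : IsClosed (PiXW l : Set (profiniteCompletion W)) :=
  (PiXW l).isClosed_of_isOpen (isOpen_PiXW l)

/-- **`Π_C̲ := ρ̂⁻¹{1, s r₀}`** (abc-iut-L5-d4's `dihCbar`; the orbicurve `C̲ = X̲/⟨ι̲⟩ → C`, degree `l`, NOT Galois).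
[cite: Mochizuki2012, IUTchI §1 p.37] -/
def PiCbarW : Subgroup (profiniteCompletion W) := (ProLModel.dihCbar l).comap (ρhat l)

/-- Membership in `Π_C̲`. [cite: Mochizuki2012, IUTchI §1 p.37] -/
theorem mem_PiCbarW_iff (g : profiniteCompletion W) : g ∈ PiCbarW l ↔ ρhat l g = 1 ∨ ρhat l g = sr 0 := Iff.rfl

/-- `Π_C̲` is open. [cite: Mochizuki2012, IUTchI §1 p.37] -/
theorem isOpen_PiCbarW : IsOpen (PiCbarW l : Set (profiniteCompletion W)) :=
  isOpen_ρhat_preimage l (ProLModel.dihCbar l : Set (DihedralGroup l))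

/-- **`Π_X ∩ Π_C̲ = Ker ρ̂ = Π_X̲`** (the `l`-cusped torus `X̲`, Galois over `C` with group `D_l`).
[cite: Mochizuki2012, IUTchI §1 p.37] -/
theorem PiXW_inf_PiCbarW : PiXW l ⊓ PiCbarW l = (ρhat l).ker := by
  ext g
  rw [Subgroup.mem_inf, mem_PiXW_iff, mem_PiCbarW_iff, MonoidHom.mem_ker]
  constructor
  · rintro ⟨⟨k, hk⟩, h1 | h1⟩
    · exact h1
    · rw [hk] at h1; cases h1
  · intro h
    exact ⟨⟨0, by rw [h, one_def]⟩, Or.inl h⟩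

/-- An element of `Π_C̲` outside `Π_X` maps to `s r₀`. [cite: Mochizuki2012, IUTchI §1 p.37] -/
theorem ρhat_eq_sr_of_mem_PiCbarW {c : profiniteCompletion W} (hc : c ∈ PiCbarW l) (hcX : c ∉ PiXW l) :
    ρhat l c = sr 0 := by
  rcases hc with h1 | h1
  · exact absurd ((mem_PiXW_iff l c).2 ⟨0, by rw [h1, one_def]⟩) hcX
  · exact h1

/-- `η(w) ∈ Π_X ↔ w ∈ F₂` (`= inl(F₂)`): `ρ(inl x · inr t)` is a rotation iff `t = 1`. [cite: Mochizuki2012, IUTchI §1 p.37] -/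
theorem eta_mem_PiXW_iff (w : W) :
    toCompletion W w ∈ PiXW l ↔ w ∈ (SemidirectProduct.inl : FreeGroup (Fin 2) →* W).range := by
  rw [PiXW, MonoidHom.mem_ker, MonoidHom.comp_apply, ρhat_eta, SemidirectProduct.range_inl_eq_ker_rightHom,
    MonoidHom.mem_ker, SemidirectProduct.rightHom_eq_right]
  rw [← SemidirectProduct.inl_left_mul_inr_right w, map_mul, ρW_inl, ρW_inr, map_mul]
  have hrot : sgnD l (ρF l w.left) = 1 := by
    refine FreeGroup.induction_on w.left (by rw [map_one, map_one]) (fun i => ?_) (fun i h => ?_)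
      (fun x y hx hy => by rw [map_mul, map_mul, hx, hy, mul_one])
    · fin_cases i
      · exact (sgnD_eq_one_iff l _).2 ⟨1, ρF_ga l⟩
      · exact (sgnD_eq_one_iff l _).2 ⟨0, by rw [← one_def]; exact ρF_gb l⟩
    · rw [map_inv, map_inv, h, inv_one]
  rw [hrot, one_mul, SemidirectProduct.mul_right, SemidirectProduct.right_inl, SemidirectProduct.right_inr,
    one_mul]
  have hcases : w.right = 1 ∨ w.right = gσ := by generalize w.right = g; revert g; decide
  rcases hcases with h | h
  · rw [h, map_one]; exact ⟨fun _ => rfl, fun _ => rfl⟩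
  · rw [h, ρ2_gσ, sgnD_sr]

/-! ### §3. The extension `Ŵ ↠ G_k = 1` -/

/-- **The extension `Π_C := Ŵ ↠ G_k := 1`** (an algebraically closed base; `Δ_C = Π_C`).
[cite: Mochizuki2012, IUTchI §1 p.37] -/
abbrev ext : FundamentalExtension.{0} where
  arith := profiniteCompletion W
  gal := ProfiniteGrp.of ProLModel.Gal
  aug := 1
  aug_surjective _ := ⟨1, Subsingleton.elim _ _⟩

/-- `Δ_C = Ŵ`. [cite: Mochizuki2012, IUTchI §1 p.37] -/
theorem ext_geom_eq_top : ext.geom = ⊤ := by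
  ext x
  simp only [Subgroup.mem_top, iff_true]
  exact Subsingleton.elim _ _

/-! ### §4. The cusps `ℤ/l` and their decomposition groups -/

/-- `lab (sec i) = i`. [cite: Mochizuki2012, IUTchI §1 p.37] -/
theorem lab_sec (i : ZMod l) : lab l (sec l i) = i := by
  haveI : NeZero l := neZero_l l
  rw [lab, sec, Int.cast_natCast, ZMod.natCast_zmod_val, add_sub_cancel_right]

/-- `⟨η(γ_n)⟩⁻ ≤ Ker ρ̂` for every `n`. [cite: Mochizuki2012, IUTchI §1 p.37] -/
theorem closure_zpowers_eta_γ_le_ker (n : ℤ) :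
    (Subgroup.zpowers (toCompletion W (SemidirectProduct.inl (γ n)))).topologicalClosure ≤ (ρhat l).ker := by
  refine Subgroup.topologicalClosure_minimal _ ?_ (isClosed_ker_ρhat l)
  rw [Subgroup.zpowers_le, MonoidHom.mem_ker, ρhat_eta, ρW_inl, ρF_γ]

/-- `D_i ≤ Ker ρ̂ = Π_X̲`. [cite: Mochizuki2012, IUTchI §1 p.37] -/
theorem decompW_le_ker (i : ZMod l) : decompW l i ≤ (ρhat l).ker :=
  closure_zpowers_eta_γ_le_ker l _

/-- `D_i ≤ Π_X ∩ Π_C̲`. [cite: Mochizuki2012, IUTchI §1 p.37] -/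
theorem decompW_le (i : ZMod l) : decompW l i ≤ PiXW l ⊓ PiCbarW l := by
  rw [PiXW_inf_PiCbarW]; exact decompW_le_ker l i

/-! ### §5. The datum -/

/-- **The dihedral profinite §1 model datum** (`l ≥ 5` prime): `Π_C := Ŵ = (F₂ ⋊ ℤ/2)^∧ ↠ G_k := 1`,
`Π_X := ρ̂⁻¹(rotations)`, `Π_C̲ := ρ̂⁻¹{1, s r₀}`, cusps `ℤ/l` with `D_i := ⟨η(γ_{sec i})⟩⁻`, `ε⁰, ε′, ε″, 2ε :=
0, 1, −1, 2`; hypothesis (∗) holds because `G_k = 1`. [cite: Mochizuki2012, IUTchI §1 p.37] -/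
abbrev datum (h5 : 5 ≤ l) : PuncturedEllipticData.{0} :=
  { l := l
    five_le := h5
    coprime_six := ProLModel.coprime_six_of_prime l h5
    E := ext
    PiX := PiXW l
    PiCbar := PiCbarW l
    isOpen_piX := isOpen_PiXW l
    isOpen_piCbar := isOpen_PiCbarW l
    index_piX := index_PiXW l
    aug_piX := fun _ => ⟨1, Subsingleton.elim _ _⟩
    aug_piCbar := fun _ => ⟨1, Subsingleton.elim _ _⟩
    star := by
      intro g hg x hx
      have hg' : g ∈ PiXW l ⊓ ext.geom := ⟨hg, by rw [ext_geom_eq_top]; trivial⟩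
      refine Subgroup.le_topologicalClosure _ (Subgroup.mem_sup_left ?_)
      rw [← commutatorElement_def]
      exact Subgroup.commutator_mem_commutator hg' hx
    Cusp := ZMod l
    decomp := decompW l
    decomp_le := decompW_le l
    ε0 := 0
    ε1 := 1
    ε2 := -1
    twoε := 2
    ε1_ne_ε0 := (ArrowModel.cusp_facts_of_five_le l h5).1
    ε2_ne_ε0 := (ArrowModel.cusp_facts_of_five_le l h5).2.1
    ε1_ne_ε2 := (ArrowModel.cusp_facts_of_five_le l h5).2.2.1
    twoε_ne := (ArrowModel.cusp_facts_of_five_le l h5).2.2.2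
    aug_decomp_twoε := fun _ => ⟨1, Subsingleton.elim _ _⟩ }

/-- The fields of the datum, by `rfl` (and `Δ_C = ⊤`). [cite: Mochizuki2012, IUTchI §1 p.37] -/
theorem datum_unfold (h5 : 5 ≤ l) :
    (datum l h5).PiX = PiXW l ∧ (datum l h5).PiCbar = PiCbarW l ∧ (datum l h5).PiXbar = PiXW l ⊓ PiCbarW l ∧
      (datum l h5).decomp = decompW l ∧ (datum l h5).DeltaC = ⊤ ∧ (datum l h5).l = l ∧
      (datum l h5).ε0 = 0 ∧ (datum l h5).ε1 = 1 ∧ (datum l h5).ε2 = -1 ∧ (datum l h5).twoε = 2 :=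
  ⟨rfl, rfl, rfl, rfl, ext_geom_eq_top, rfl, rfl, rfl, rfl, rfl⟩

/-- `Π_X̲ = Ker ρ̂` at the datum. [cite: Mochizuki2012, IUTchI §1 p.37] -/
theorem datum_PiXbar (h5 : 5 ≤ l) : (datum l h5).PiXbar = (ρhat l).ker := PiXW_inf_PiCbarW l

/-- `Δ_X = Π_X` at the datum (`G_k = 1`). [cite: Mochizuki2012, IUTchI §1 p.37] -/
theorem datum_deltaX (h5 : 5 ≤ l) : (datum l h5).PiX ⊓ (datum l h5).DeltaC = PiXW l := by
  have h : (datum l h5).DeltaC = ⊤ := ext_geom_eq_top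
  rw [h, inf_top_eq]

/-- `Δ_X̲ = Ker ρ̂` at the datum. [cite: Mochizuki2012, IUTchI §1 p.37] -/
theorem datum_deltaXbar (h5 : 5 ≤ l) : (datum l h5).DeltaXbar = (ρhat l).ker := by
  have h : (datum l h5).DeltaC = ⊤ := ext_geom_eq_top
  rw [DeltaXbar, h, inf_top_eq, datum_PiXbar]

/-- `Δ_C̲ = Π_C̲` at the datum. [cite: Mochizuki2012, IUTchI §1 p.37] -/
theorem datum_deltaCbar (h5 : 5 ≤ l) : (datum l h5).DeltaCbar = PiCbarW l := by
  have h : (datum l h5).DeltaC = ⊤ := ext_geom_eq_top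
  rw [DeltaCbar, h, inf_top_eq]

/-- `I_i = D_i` at the datum (`G_k = 1`). [cite: Mochizuki2012, IUTchI §1 p.37] -/
theorem datum_inertia (h5 : 5 ≤ l) (i : ZMod l) : (datum l h5).inertia i = decompW l i := by
  have h : (datum l h5).DeltaC = ⊤ := ext_geom_eq_top
  rw [inertia, h, inf_top_eq]

end DihedralProfiniteModel

end PuncturedEllipticData

end Literature.IUT.HodgeTheaters

end
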